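/-
Copyright (c) 2026 the pub-hodgecm-mathlib formalisation cell (harness21).  Prover seat hodgecm-mathlib-K2E4-p14 (g6), Track B ∕ K2-LIT, h413 =
`stmt-HodgeConjecture-24833`, line `K2_E1_TraceFormulaBeta`, campaign «EIS-WHITTAKER-2», deck #1a «W2-fin-S»; DEAL of the dealer K2E1-plan (g4) 2026-09-04T07:35:50Z ∕
07:36:03Z (REPORT-FIRST census∕heads on the K2 bus).
-/
import Summits.HodgeConjecture.HodgeConjecture.Theorems.K2E1FiniteWhittakerPolynomial   -- ★ p858310 (K2-defs1 g4): W2-fin, the `max(1,‖t‖)^{−2z}` case; brings ★ Tate local files, ★ p858040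
import HarnessLib

/-!
# h413 ∕ Track B «K2-LIT», «EIS-WHITTAKER-2» deck #1a «W2-fin-S» — `K2E1FiniteWhittakerStepSymbol`: over a non-archimedean local field `F`, for a RADIAL STEP SYMBOL `P`,
# `∫_F P(t)^{−z} ψ(tξ) dμ(t)` is a FINITE SHELL SUM — entire in `z`, bounded on `Re z ≥ ½`, vanishing below the conductor-shifted threshold

Cell `pub/hodgecm-mathlib`, crux H413 = `stmt-HodgeConjecture-24833`, route `HCCMUnconditional`; dealer K2E1-plan (g4), wiring memo of K2E1b-plan (g5) (W5-FINAL queue #4, lemma #1a).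
THEOREMS ONLY (no `def`, no `instance`, no `notation`, no named-fact hypothesis, no `sorry`); lane `--kind proof --supports stmt-HodgeConjecture-24833 --as helper` (count-neutral).
Currency = ★ p858310's: `F` with `[IsNonarchimedeanLocalField F]`, `q = residueFieldCard F`, balls `𝔭^j = primePowBall F j`, any additive Haar measure `μ`, `ψ : AddChar F Circle` continuous
of conductor exponent `m` (`ψ.HasConductorExp m`), character `((ψ (t * ξ) : Circle) : ℂ)`.

THE STEP SYMBOL (hypothesis-first; the instance is the local factor `P_v(t) = ∏_{w∣v} max(1, ‖ι_w t‖_w·‖δ‖_w)` of ★ p858204 §3 at the finitely many places `v ∈ S_δ` of the base of the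
CM quadratic extension, where ★ p858310's `max(1,‖t‖)²` is the generic-place value): a function `P : F → ℝ` with
  (w0) `P` continuous and `P ≥ 1`;   (w1) `P = 1` on a base ball `𝔭^a`;   (w2) `P = p_k` (a constant `≥ 1`) on each shell `𝔭^{a−k−1} ∖ 𝔭^{a−k}`, `k ≥ 0`.
THE COMPUTATION (Tate 1950 §2.5, exactly as in ★ p858310 with the weight's three uses abstracted).  `J_j := ∫_{𝔭^j} ψ(tξ) dμ = 𝟙[ξ ∈ 𝔭^{m−j}]·μ(𝔭^j)` (★ orthogonality).
§1 THE BALL FORMULA, every `z`: `∫_{𝔭^{a−K}} P^{−z} ψ(tξ) dμ = J_a + Σ_{k<K} p_k^{−z}·(J_{a−k−1} − J_{a−k})`.  §2 If `ξ ∈ 𝔭^{m−a+n} ∖ 𝔭^{m−a+n+1}` (`n = ord ξ − m + a ≥ 0`) the `J_{a−k}` vanish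
for `k > n`, so the ball integrals are CONSTANT in `K > n`, equal to the SHELL SUM **`S(z) = μ(𝔭^a) + Σ_{k<n} p_k^{−z}(μ(𝔭^{a−k−1}) − μ(𝔭^{a−k})) − p_n^{−z} μ(𝔭^{a−n})`**; if `ξ ∉ 𝔭^{m−a}`
(`ord ξ < m − a`, the conductor-shifted threshold) EVERY ball integral vanishes.  §3 `S` is ENTIRE (`p_k^{−z} = e^{−z log p_k}`, `p_k ≥ 1`); on `Re z ≥ 0`, `‖S(z)‖ ≤ μ(𝔭^a) +
Σ_{k<n} p_k^{−Re z}(μ(𝔭^{a−k−1}) + μ(𝔭^{a−k})) + p_n^{−Re z}μ(𝔭^{a−n})`, on `Re z ≥ ½` the `z`-free bound with `p_k^{−1∕2}`, and under the growth `c·q^{2(k+1−a)} ≤ p_k` (the instance: `P_v ≥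
c_δ·max(1,‖t‖)²`) the bound LINEAR in `n`: `‖S(z)‖ ≤ (q^{−a} + (2n+1)·c^{−1∕2})·μ(𝒪)`; and for an integrand integrable on `F` (the instance: `Re z > ½` by domination from ★ p858040),
`∫_F P^{−z} ψ(tξ) dμ = lim_K ∫_{𝔭^{a−K}} = S(z)` (resp. `= 0` below the threshold).

* §1 `integrableOn_stepSymbol_mul_addChar`, `setIntegral_ball_succ_stepSymbol_mul_addChar` (one shell), **`setIntegral_ball_stepSymbol_mul_addChar_eq_sum`** (the ball formula, all `z`).
* §2 `setIntegral_ball_addChar_eq_ite` (`J_{a−k}`), **`setIntegral_ball_stepSymbol_mul_addChar_eq_shellSum`** (`K > n`), **`setIntegral_ball_stepSymbol_mul_addChar_eq_zero_of_not_mem`**.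
* §3 **`differentiable_shellSum`** (entire), **`norm_shellSum_le`** (`Re z ≥ 0`), `norm_shellSum_le_of_half_le` (`Re z ≥ ½`, `z`-free), **`norm_shellSum_le_linear`** (growth ⟹ linear in `n`),
  `iUnion_ball_sub_nat`, `tendsto_setIntegral_ball_stepSymbol_mul_addChar`, **`integral_stepSymbol_mul_addChar_eq_shellSum`**, **`integral_stepSymbol_mul_addChar_eq_zero_of_not_mem`**.
HONEST LABEL.  Count-neutral helper; proves no printed statement; HC_CM is proved only modulo the 7 printed citations (2 remaining named inputs: hLiu418 =
`stmt-HodgeConjecture-24832`, h413 = `stmt-HodgeConjecture-24833`) until rung 0 closes.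

## References
* [Tate1950] J. Tate, *Fourier analysis in number fields and Hecke's zeta-functions* (1950), §2.5, in [CasselsFrohlichANT1967] Ch. XV.
* [Casselman1980] W. Casselman, *The unramified principal series of p-adic groups I*, Compositio Math. 40 (1980), §3.
* [JacquetLanglands1970] H. Jacquet, R. P. Langlands, *Automorphic Forms on GL(2)*, LNM 114 (1970), §3 (Whittaker functions at ramified places: finite shell sums).
-/

set_option autoImplicit false
set_option linter.dupNamespace false  -- the mandated namespace repeats the summit's segment (`HodgeConjecture.HodgeConjecture`)

noncomputable section

open MeasureTheory Filter Topology Set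
open scoped NNReal ENNReal
open Literature.NumberTheory.GaloisRepresentations.IsNonarchimedeanLocalField
open Literature.NumberTheory.Automorphic Literature.NumberTheory.Automorphic.LocalFieldHaar
open Summit.HodgeConjecture.HodgeConjecture.Cruxes.HLiu418.K2LiuGKRankOneIntegral
open Summit.HodgeConjecture.HodgeConjecture.Cruxes.H413.K2E1IntertwiningLocalFactorU2
open Summit.HodgeConjecture.HodgeConjecture.Cruxes.H413.K2E1FiniteWhittakerPolynomial (iUnion_primePowBall_neg_nat)

namespace Summit.HodgeConjecture.HodgeConjecture.Cruxes.H413.K2E1FiniteWhittakerStepSymbol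

variable {F : Type*} [Field F] [ValuativeRel F] [TopologicalSpace F] [IsNonarchimedeanLocalField F]
variable [MeasurableSpace F] [BorelSpace F] (μ : Measure F) [μ.IsAddHaarMeasure]

/-! ## §1 Ball integrals of a step symbol: integrability on balls, one shell, the ball formula -/

/-- The integrand `P(t)^{−z}·ψ(tξ)` of a continuous symbol `P ≥ 1` is integrable on every ball (continuous on a compact set; `P(t) > 0` lies in the slit plane). [folklore] -/
theorem integrableOn_stepSymbol_mul_addChar {P : F → ℝ} (hPc : Continuous P) (hP1 : ∀ t, 1 ≤ P t) {ψ : AddChar F Circle} (hψ : Continuous ψ) (ξ : F) (z : ℂ) (j : ℤ) :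
    IntegrableOn (fun t : F => (((P t : ℝ) : ℂ) ^ (-z)) * ((ψ (t * ξ) : Circle) : ℂ)) (primePowBall F j) μ := by
  haveI : T2Space F := (Literature.NumberTheory.GaloisRepresentations.IsNonarchimedeanLocalField.isLocalField F).toT2Space
  have hc : Continuous fun t : F => ((P t : ℝ) : ℂ) ^ (-z) :=
    (Complex.continuous_ofReal.comp hPc).cpow continuous_const fun t => Complex.ofReal_mem_slitPlane.2 (lt_of_lt_of_le one_pos (hP1 t))
  exact ((hc.mul (continuous_subtype_val.comp (hψ.comp (continuous_id.mul continuous_const)))).continuousOn.integrableOn_compact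
    (isCompact_primePowBall j))

/-- **One shell**: on `𝔭^{a−k−1} ∖ 𝔭^{a−k}` the symbol is the constant `p_k`, so
`∫_{𝔭^{a−k−1}} P^{−z} ψ = ∫_{𝔭^{a−k}} P^{−z} ψ + p_k^{−z}·(∫_{𝔭^{a−k−1}} ψ − ∫_{𝔭^{a−k}} ψ)`. [cite: Tate1950, §2.5] -/
theorem setIntegral_ball_succ_stepSymbol_mul_addChar {P : F → ℝ} (hPc : Continuous P) (hP1 : ∀ t, 1 ≤ P t) {a : ℤ} {p : ℕ → ℝ}
    (hp : ∀ k : ℕ, ∀ t ∈ primePowBall F (a - ((k : ℤ) + 1)) \ primePowBall F (a - (k : ℤ)), P t = p k)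
    {ψ : AddChar F Circle} (hψ : Continuous ψ) (ξ : F) (z : ℂ) (k : ℕ) :
    ∫ t in primePowBall F (a - ((k : ℤ) + 1)), (((P t : ℝ) : ℂ) ^ (-z)) * ((ψ (t * ξ) : Circle) : ℂ) ∂μ =
      (∫ t in primePowBall F (a - (k : ℤ)), (((P t : ℝ) : ℂ) ^ (-z)) * ((ψ (t * ξ) : Circle) : ℂ) ∂μ) +
        ((p k : ℝ) : ℂ) ^ (-z) *
          ((∫ t in primePowBall F (a - ((k : ℤ) + 1)), ((ψ (t * ξ) : Circle) : ℂ) ∂μ) - ∫ t in primePowBall F (a - (k : ℤ)), ((ψ (t * ξ) : Circle) : ℂ) ∂μ) := by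
  have hsub : primePowBall F (a - (k : ℤ)) ⊆ primePowBall F (a - ((k : ℤ) + 1)) := primePowBall_antitone (by omega)
  -- split the big ball into the small ball and the shell
  have hsplit : ∀ (g : F → ℂ), IntegrableOn g (primePowBall F (a - ((k : ℤ) + 1))) μ →
      ∫ t in primePowBall F (a - ((k : ℤ) + 1)), g t ∂μ =
        (∫ t in primePowBall F (a - (k : ℤ)), g t ∂μ) + ∫ t in primePowBall F (a - ((k : ℤ) + 1)) \ primePowBall F (a - (k : ℤ)), g t ∂μ := by
    intro g hg
    rw [setIntegral_sdiff (measurableSet_primePowBall _) hg hsub]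
    ring
  rw [hsplit _ (integrableOn_stepSymbol_mul_addChar μ hPc hP1 hψ ξ z _)]
  congr 1
  -- on the shell the symbol is constant
  have hconst : ∀ t ∈ primePowBall F (a - ((k : ℤ) + 1)) \ primePowBall F (a - (k : ℤ)),
      (((P t : ℝ) : ℂ) ^ (-z)) * ((ψ (t * ξ) : Circle) : ℂ) = ((p k : ℝ) : ℂ) ^ (-z) * ((ψ (t * ξ) : Circle) : ℂ) := fun t ht => by
    rw [hp k t ht]
  rw [setIntegral_congr_fun ((measurableSet_primePowBall _).diff (measurableSet_primePowBall _)) hconst, integral_const_mul,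
    setIntegral_sdiff (measurableSet_primePowBall _) (K2E1FiniteWhittakerPolynomial.integrableOn_addChar μ hψ ξ _) hsub]

/-- **THE BALL FORMULA, every `z`**: `∫_{𝔭^{a−K}} P^{−z} ψ(tξ) dμ = J_a + Σ_{k<K} p_k^{−z}·(J_{a−k−1} − J_{a−k})`, `J_j = ∫_{𝔭^j} ψ(tξ) dμ` (`P = 1` on `𝔭^a`, then shell by shell).
[cite: Tate1950, §2.5] [cite: Casselman1980, §3] -/
theorem setIntegral_ball_stepSymbol_mul_addChar_eq_sum {P : F → ℝ} (hPc : Continuous P) (hP1 : ∀ t, 1 ≤ P t) {a : ℤ} (hPa : ∀ t ∈ primePowBall F a, P t = 1) {p : ℕ → ℝ}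
    (hp : ∀ k : ℕ, ∀ t ∈ primePowBall F (a - ((k : ℤ) + 1)) \ primePowBall F (a - (k : ℤ)), P t = p k)
    {ψ : AddChar F Circle} (hψ : Continuous ψ) (ξ : F) (z : ℂ) (K : ℕ) :
    ∫ t in primePowBall F (a - (K : ℤ)), (((P t : ℝ) : ℂ) ^ (-z)) * ((ψ (t * ξ) : Circle) : ℂ) ∂μ =
      (∫ t in primePowBall F a, ((ψ (t * ξ) : Circle) : ℂ) ∂μ) +
        ∑ k ∈ Finset.range K, ((p k : ℝ) : ℂ) ^ (-z) *
          ((∫ t in primePowBall F (a - ((k : ℤ) + 1)), ((ψ (t * ξ) : Circle) : ℂ) ∂μ) - ∫ t in primePowBall F (a - (k : ℤ)), ((ψ (t * ξ) : Circle) : ℂ) ∂μ) := by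
  induction K with
  | zero =>
    rw [Finset.sum_range_zero, add_zero, Nat.cast_zero, sub_zero]
    refine setIntegral_congr_fun (measurableSet_primePowBall a) fun t ht => ?_
    rw [hPa t ht, Complex.ofReal_one, Complex.one_cpow, one_mul]
  | succ K ih =>
    rw [Nat.cast_succ, setIntegral_ball_succ_stepSymbol_mul_addChar μ hPc hP1 hp hψ ξ z K, ih, Finset.sum_range_succ]
    ring

/-! ## §2 The stable value on large balls: the shell sum, and the vanishing below the threshold -/

/-- **`J_{a−k}`** when `ξ ∈ 𝔭^{m−a+n} ∖ 𝔭^{m−a+n+1}`: `∫_{𝔭^{a−k}} ψ(tξ) dμ = μ(𝔭^{a−k})` for `k ≤ n` and `= 0` for `n < k` (★ Tate orthogonality `setIntegral_primePowBall_addChar_mul`).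
[cite: Tate1950, §2.5] -/
theorem setIntegral_ball_addChar_eq_ite {ψ : AddChar F Circle} {m : ℤ} (hm : ψ.HasConductorExp m) {a : ℤ} {ξ : F} {n : ℕ}
    (hn : ξ ∈ primePowBall F (m - a + n)) (hn' : ξ ∉ primePowBall F (m - a + n + 1)) (k : ℕ) :
    ∫ t in primePowBall F (a - (k : ℤ)), ((ψ (t * ξ) : Circle) : ℂ) ∂μ =
      if k ≤ n then (μ.real (primePowBall F (a - (k : ℤ))) : ℂ) else 0 := by
  rw [setIntegral_primePowBall_addChar_mul μ hm (a - (k : ℤ)) ξ, show m - (a - (k : ℤ)) = m - a + (k : ℤ) by ring]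
  by_cases hk : k ≤ n
  · rw [if_pos (primePowBall_antitone (show m - a + (k : ℤ) ≤ m - a + (n : ℤ) by omega) hn : ξ ∈ primePowBall F (m - a + (k : ℤ))), if_pos hk]
  · rw [if_neg (fun h : ξ ∈ primePowBall F (m - a + (k : ℤ)) => hn' (primePowBall_antitone (show m - a + (n : ℤ) + 1 ≤ m - a + (k : ℤ) by omega) h)), if_neg hk]

/-- **THE SHELL SUM ON LARGE BALLS**: if `ξ ∈ 𝔭^{m−a+n} ∖ 𝔭^{m−a+n+1}` (`n = ord ξ − m + a ≥ 0`) then for every `K > n` and EVERY `z`,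
`∫_{𝔭^{a−K}} P^{−z} ψ(tξ) dμ = S(z) := μ(𝔭^a) + Σ_{k<n} p_k^{−z}(μ(𝔭^{a−k−1}) − μ(𝔭^{a−k})) − p_n^{−z}·μ(𝔭^{a−n})` — independent of `K`: a FINITE shell sum.
[cite: Tate1950, §2.5] [cite: JacquetLanglands1970, §3] -/
theorem setIntegral_ball_stepSymbol_mul_addChar_eq_shellSum {P : F → ℝ} (hPc : Continuous P) (hP1 : ∀ t, 1 ≤ P t) {a : ℤ} (hPa : ∀ t ∈ primePowBall F a, P t = 1) {p : ℕ → ℝ}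
    (hp : ∀ k : ℕ, ∀ t ∈ primePowBall F (a - ((k : ℤ) + 1)) \ primePowBall F (a - (k : ℤ)), P t = p k)
    {ψ : AddChar F Circle} (hψ : Continuous ψ) {m : ℤ} (hm : ψ.HasConductorExp m)
    {ξ : F} {n : ℕ} (hn : ξ ∈ primePowBall F (m - a + n)) (hn' : ξ ∉ primePowBall F (m - a + n + 1)) (z : ℂ) {K : ℕ} (hK : n < K) :
    ∫ t in primePowBall F (a - (K : ℤ)), (((P t : ℝ) : ℂ) ^ (-z)) * ((ψ (t * ξ) : Circle) : ℂ) ∂μ =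
      (μ.real (primePowBall F a) : ℂ) +
        (∑ k ∈ Finset.range n, ((p k : ℝ) : ℂ) ^ (-z) * ((μ.real (primePowBall F (a - ((k : ℤ) + 1))) : ℂ) - (μ.real (primePowBall F (a - (k : ℤ))) : ℂ))) -
        ((p n : ℝ) : ℂ) ^ (-z) * (μ.real (primePowBall F (a - (n : ℤ))) : ℂ) := by
  have hJ := setIntegral_ball_addChar_eq_ite μ hm hn hn'
  -- the terms of the ball formula vanish beyond `n`
  have hterm0 : ∀ k, n < k →
      ((p k : ℝ) : ℂ) ^ (-z) * ((∫ t in primePowBall F (a - ((k : ℤ) + 1)), ((ψ (t * ξ) : Circle) : ℂ) ∂μ) - ∫ t in primePowBall F (a - (k : ℤ)), ((ψ (t * ξ) : Circle) : ℂ) ∂μ) = 0 := by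
    intro k hk
    have h1 := hJ (k + 1)
    rw [Nat.cast_succ] at h1
    rw [h1, hJ k, if_neg (by omega), if_neg (by omega), sub_zero, mul_zero]
  have hstab : ∀ j : ℕ, ∑ k ∈ Finset.range (n + 1 + j), ((p k : ℝ) : ℂ) ^ (-z) *
      ((∫ t in primePowBall F (a - ((k : ℤ) + 1)), ((ψ (t * ξ) : Circle) : ℂ) ∂μ) - ∫ t in primePowBall F (a - (k : ℤ)), ((ψ (t * ξ) : Circle) : ℂ) ∂μ) =
      ∑ k ∈ Finset.range (n + 1), ((p k : ℝ) : ℂ) ^ (-z) *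
        ((∫ t in primePowBall F (a - ((k : ℤ) + 1)), ((ψ (t * ξ) : Circle) : ℂ) ∂μ) - ∫ t in primePowBall F (a - (k : ℤ)), ((ψ (t * ξ) : Circle) : ℂ) ∂μ) := by
    intro j
    induction j with
    | zero => rw [add_zero]
    | succ j ih => rw [← add_assoc, Finset.sum_range_succ, ih, hterm0 _ (by omega), add_zero]
  obtain ⟨j, rfl⟩ : ∃ j, K = n + 1 + j := ⟨K - (n + 1), by omega⟩
  rw [setIntegral_ball_stepSymbol_mul_addChar_eq_sum μ hPc hP1 hPa hp hψ ξ z, hstab j, Finset.sum_range_succ]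
  -- evaluate `J_a`, the terms `k < n`, and the term `k = n`
  have hJ0 : ∫ t in primePowBall F a, ((ψ (t * ξ) : Circle) : ℂ) ∂μ = (μ.real (primePowBall F a) : ℂ) := by
    have h := hJ 0
    rw [Nat.cast_zero, sub_zero] at h
    rw [h, if_pos (Nat.zero_le n)]
  have hmid : ∑ k ∈ Finset.range n, ((p k : ℝ) : ℂ) ^ (-z) *
      ((∫ t in primePowBall F (a - ((k : ℤ) + 1)), ((ψ (t * ξ) : Circle) : ℂ) ∂μ) - ∫ t in primePowBall F (a - (k : ℤ)), ((ψ (t * ξ) : Circle) : ℂ) ∂μ) =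
      ∑ k ∈ Finset.range n, ((p k : ℝ) : ℂ) ^ (-z) * ((μ.real (primePowBall F (a - ((k : ℤ) + 1))) : ℂ) - (μ.real (primePowBall F (a - (k : ℤ))) : ℂ)) := by
    refine Finset.sum_congr rfl fun k hk => ?_
    have hk' : k < n := Finset.mem_range.1 hk
    have h1 := hJ (k + 1)
    rw [Nat.cast_succ] at h1
    rw [h1, hJ k, if_pos (by omega), if_pos hk'.le]
  have hlast : ((p n : ℝ) : ℂ) ^ (-z) * ((∫ t in primePowBall F (a - ((n : ℤ) + 1)), ((ψ (t * ξ) : Circle) : ℂ) ∂μ) - ∫ t in primePowBall F (a - (n : ℤ)), ((ψ (t * ξ) : Circle) : ℂ) ∂μ) =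
      -(((p n : ℝ) : ℂ) ^ (-z) * (μ.real (primePowBall F (a - (n : ℤ))) : ℂ)) := by
    have h1 := hJ (n + 1)
    rw [Nat.cast_succ] at h1
    rw [h1, hJ n, if_neg (by omega), if_pos le_rfl, zero_sub, mul_neg]
  rw [hJ0, hmid, hlast]
  ring

/-- **VANISHING BELOW THE THRESHOLD**: if `ξ ∉ 𝔭^{m−a}` (`ord ξ < m − a`) every `J_{a−k} = 0`, so `∫_{𝔭^{a−K}} P^{−z} ψ(tξ) dμ = 0` for every `K` and every `z`. [cite: Tate1950, §2.5] -/
theorem setIntegral_ball_stepSymbol_mul_addChar_eq_zero_of_not_mem {P : F → ℝ} (hPc : Continuous P) (hP1 : ∀ t, 1 ≤ P t) {a : ℤ} (hPa : ∀ t ∈ primePowBall F a, P t = 1)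
    {p : ℕ → ℝ} (hp : ∀ k : ℕ, ∀ t ∈ primePowBall F (a - ((k : ℤ) + 1)) \ primePowBall F (a - (k : ℤ)), P t = p k)
    {ψ : AddChar F Circle} (hψ : Continuous ψ) {m : ℤ} (hm : ψ.HasConductorExp m) {ξ : F} (hξ : ξ ∉ primePowBall F (m - a)) (z : ℂ) (K : ℕ) :
    ∫ t in primePowBall F (a - (K : ℤ)), (((P t : ℝ) : ℂ) ^ (-z)) * ((ψ (t * ξ) : Circle) : ℂ) ∂μ = 0 := by
  have hJ : ∀ k : ℕ, ∫ t in primePowBall F (a - (k : ℤ)), ((ψ (t * ξ) : Circle) : ℂ) ∂μ = 0 := fun k => by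
    rw [setIntegral_primePowBall_addChar_mul μ hm (a - (k : ℤ)) ξ, show m - (a - (k : ℤ)) = m - a + (k : ℤ) by ring,
      if_neg (fun h : ξ ∈ primePowBall F (m - a + (k : ℤ)) => hξ (primePowBall_antitone (show m - a ≤ m - a + (k : ℤ) by omega) h))]
  rw [setIntegral_ball_stepSymbol_mul_addChar_eq_sum μ hPc hP1 hPa hp hψ ξ z K]
  have h0 := hJ 0
  rw [Nat.cast_zero, sub_zero] at h0
  rw [h0, zero_add]
  refine Finset.sum_eq_zero fun k _ => ?_
  have h1 := hJ (k + 1)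
  rw [Nat.cast_succ] at h1
  rw [h1, hJ k, sub_zero, mul_zero]

/-! ## §3 The shell sum is entire and bounded on `Re z ≥ 0`; the whole-`F` integral -/

omit [MeasurableSpace F] [BorelSpace F] in
/-- **The shell sum is ENTIRE in `z`** (a finite combination of `p_k^{−z} = e^{−z·log p_k}`, `p_k ≥ 1`). -/
theorem differentiable_shellSum {p : ℕ → ℝ} (hp1 : ∀ k, 1 ≤ p k) (M₀ Mn : ℂ) (M M' : ℕ → ℂ) (n : ℕ) :
    Differentiable ℂ fun z : ℂ => M₀ + (∑ k ∈ Finset.range n, ((p k : ℝ) : ℂ) ^ (-z) * (M k - M' k)) - ((p n : ℝ) : ℂ) ^ (-z) * Mn := by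
  have hterm : ∀ k, Differentiable ℂ fun z : ℂ => ((p k : ℝ) : ℂ) ^ (-z) := fun k =>
    differentiable_id.neg.const_cpow (Or.inl (Complex.ofReal_ne_zero.2 (lt_of_lt_of_le one_pos (hp1 k)).ne'))
  refine ((differentiable_const M₀).add (Differentiable.fun_sum fun k _ => (hterm k).mul_const _)).sub ((hterm n).mul_const _)

omit [MeasurableSpace F] [BorelSpace F] in
/-- `‖p^{−z}‖ = p^{−Re z} ≤ p^{−σ}` for `p ≥ 1` and `σ ≤ Re z`. [folklore] -/
theorem norm_cpow_neg_le {p : ℝ} (hp : 1 ≤ p) {σ : ℝ} {z : ℂ} (hz : σ ≤ z.re) : ‖((p : ℝ) : ℂ) ^ (-z)‖ ≤ p ^ (-σ) := by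
  rw [Complex.norm_cpow_eq_rpow_re_of_pos (lt_of_lt_of_le one_pos hp), Complex.neg_re]
  exact Real.rpow_le_rpow_of_exponent_le hp (neg_le_neg hz)

omit [BorelSpace F] [μ.IsAddHaarMeasure] in
/-- **The bound on `Re z ≥ σ`** (`σ` real, e.g. `0` or `½`): `‖S(z)‖ ≤ μ(𝔭^a) + Σ_{k<n} p_k^{−σ}·(μ(𝔭^{a−k−1}) + μ(𝔭^{a−k})) + p_n^{−σ}·μ(𝔭^{a−n})` — `z`-free. -/
theorem norm_shellSum_le {p : ℕ → ℝ} (hp1 : ∀ k, 1 ≤ p k) (a : ℤ) (n : ℕ) {σ : ℝ} {z : ℂ} (hz : σ ≤ z.re) :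
    ‖(μ.real (primePowBall F a) : ℂ) +
        (∑ k ∈ Finset.range n, ((p k : ℝ) : ℂ) ^ (-z) * ((μ.real (primePowBall F (a - ((k : ℤ) + 1))) : ℂ) - (μ.real (primePowBall F (a - (k : ℤ))) : ℂ))) -
        ((p n : ℝ) : ℂ) ^ (-z) * (μ.real (primePowBall F (a - (n : ℤ))) : ℂ)‖ ≤
      μ.real (primePowBall F a) + (∑ k ∈ Finset.range n, p k ^ (-σ) * (μ.real (primePowBall F (a - ((k : ℤ) + 1))) + μ.real (primePowBall F (a - (k : ℤ))))) +
        p n ^ (-σ) * μ.real (primePowBall F (a - (n : ℤ))) := by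
  refine (norm_sub_le _ _).trans (add_le_add ((norm_add_le _ _).trans (add_le_add ?_ ((norm_sum_le _ _).trans (Finset.sum_le_sum fun k _ => ?_)))) ?_)
  · rw [Complex.norm_real, Real.norm_of_nonneg measureReal_nonneg]
  · rw [norm_mul]
    refine mul_le_mul (norm_cpow_neg_le (hp1 k) hz) ((norm_sub_le _ _).trans (le_of_eq ?_)) (norm_nonneg _) (Real.rpow_nonneg (zero_le_one.trans (hp1 k)) _)
    rw [Complex.norm_real, Complex.norm_real, Real.norm_of_nonneg measureReal_nonneg, Real.norm_of_nonneg measureReal_nonneg]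
  · rw [norm_mul, Complex.norm_real, Real.norm_of_nonneg measureReal_nonneg]
    exact mul_le_mul_of_nonneg_right (norm_cpow_neg_le (hp1 n) hz) measureReal_nonneg

/-- **LINEAR IN `n` UNDER GROWTH** (`Re z ≥ ½`): if `c·q^{2(k+1−a)} ≤ p_k` for all `k` (`c > 0`; the instance `P_v ≥ c_δ·max(1,‖t‖)²` has this with `c = c_δ`), then
`‖S(z)‖ ≤ (q^{−a} + (2n + 1)·c^{−1∕2})·μ(𝒪)`: each shell term is `≤ c^{−1∕2}·q^{−(k+1−a)}·(μ(𝔭^{a−k−1}) + μ(𝔭^{a−k})) ≤ 2c^{−1∕2}μ(𝒪)` by `μ(𝔭^j) = q^{−j}μ(𝒪)` (★ `measureReal_primePowBall`).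
[cite: JacquetLanglands1970, §3] -/
theorem norm_shellSum_le_linear {p : ℕ → ℝ} (hp1 : ∀ k, 1 ≤ p k) (a : ℤ) (n : ℕ) {c : ℝ} (hc0 : 0 < c)
    (hc : ∀ k : ℕ, c * (residueFieldCard F : ℝ) ^ (2 * (((k : ℤ) + 1) - a)) ≤ p k) {z : ℂ} (hz : 1 / 2 ≤ z.re) :
    ‖(μ.real (primePowBall F a) : ℂ) +
        (∑ k ∈ Finset.range n, ((p k : ℝ) : ℂ) ^ (-z) * ((μ.real (primePowBall F (a - ((k : ℤ) + 1))) : ℂ) - (μ.real (primePowBall F (a - (k : ℤ))) : ℂ))) -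
        ((p n : ℝ) : ℂ) ^ (-z) * (μ.real (primePowBall F (a - (n : ℤ))) : ℂ)‖ ≤
      ((residueFieldCard F : ℝ) ^ (-a) + (2 * n + 1) * c ^ (-(1 / 2 : ℝ))) * μ.real (primePowBall F 0) := by
  have hq1 : (1 : ℝ) < residueFieldCard F := one_lt_residueFieldCard_real
  have hq0 : (0 : ℝ) < residueFieldCard F := one_pos.trans hq1
  have hμ0 : 0 ≤ μ.real (primePowBall F 0) := measureReal_nonneg
  have hcs : 0 ≤ c ^ (-(1 / 2 : ℝ)) := Real.rpow_nonneg hc0.le _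
  -- `μ(𝔭^j) = q^{−j} μ(𝒪)`
  have hμ : ∀ j : ℤ, μ.real (primePowBall F j) = (residueFieldCard F : ℝ) ^ (-j) * μ.real (primePowBall F 0) := fun j => by
    rw [measureReal_primePowBall μ j, inv_zpow', zpow_neg]
  -- `p_k^{−1/2} ≤ c^{−1/2} · q^{−(k+1−a)}`
  have hpk : ∀ k : ℕ, p k ^ (-(1 / 2 : ℝ)) ≤ c ^ (-(1 / 2 : ℝ)) * (residueFieldCard F : ℝ) ^ (-(((k : ℤ) + 1) - a)) := by
    intro k
    have hck : 0 < c * (residueFieldCard F : ℝ) ^ (2 * (((k : ℤ) + 1) - a)) := mul_pos hc0 (zpow_pos hq0 _)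
    calc p k ^ (-(1 / 2 : ℝ)) ≤ (c * (residueFieldCard F : ℝ) ^ (2 * (((k : ℤ) + 1) - a))) ^ (-(1 / 2 : ℝ)) :=
          Real.rpow_le_rpow_of_nonpos hck (hc k) (by norm_num)
      _ = c ^ (-(1 / 2 : ℝ)) * (residueFieldCard F : ℝ) ^ (-(((k : ℤ) + 1) - a)) := by
          rw [Real.mul_rpow hc0.le (zpow_pos hq0 _).le, ← Real.rpow_intCast _ (2 * _), ← Real.rpow_mul hq0.le, ← Real.rpow_intCast]
          congr 2
          push_cast
          ring
  -- each shell term `≤ 2 c^{−1/2} μ(𝒪)`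
  have hterm : ∀ k : ℕ, p k ^ (-(1 / 2 : ℝ)) * (μ.real (primePowBall F (a - ((k : ℤ) + 1))) + μ.real (primePowBall F (a - (k : ℤ)))) ≤
      2 * c ^ (-(1 / 2 : ℝ)) * μ.real (primePowBall F 0) := by
    intro k
    have hsum : μ.real (primePowBall F (a - ((k : ℤ) + 1))) + μ.real (primePowBall F (a - (k : ℤ))) ≤ 2 * ((residueFieldCard F : ℝ) ^ (((k : ℤ) + 1) - a) * μ.real (primePowBall F 0)) := by
      rw [hμ (a - ((k : ℤ) + 1)), hμ (a - (k : ℤ)), two_mul, show -(a - ((k : ℤ) + 1)) = ((k : ℤ) + 1) - a by ring, show -(a - (k : ℤ)) = (k : ℤ) - a by ring]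
      refine add_le_add le_rfl (mul_le_mul_of_nonneg_right (zpow_le_zpow_right₀ hq1.le (by omega)) hμ0)
    calc p k ^ (-(1 / 2 : ℝ)) * (μ.real (primePowBall F (a - ((k : ℤ) + 1))) + μ.real (primePowBall F (a - (k : ℤ))))
        ≤ (c ^ (-(1 / 2 : ℝ)) * (residueFieldCard F : ℝ) ^ (-(((k : ℤ) + 1) - a))) * (2 * ((residueFieldCard F : ℝ) ^ (((k : ℤ) + 1) - a) * μ.real (primePowBall F 0))) :=
          mul_le_mul (hpk k) hsum (add_nonneg measureReal_nonneg measureReal_nonneg) (mul_nonneg hcs (zpow_pos hq0 _).le)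
      _ = 2 * c ^ (-(1 / 2 : ℝ)) * μ.real (primePowBall F 0) := by
          rw [zpow_neg]
          field_simp
  -- the last term `≤ c^{−1/2} μ(𝒪)`
  have hlast : p n ^ (-(1 / 2 : ℝ)) * μ.real (primePowBall F (a - (n : ℤ))) ≤ c ^ (-(1 / 2 : ℝ)) * μ.real (primePowBall F 0) := by
    have h1 : μ.real (primePowBall F (a - (n : ℤ))) ≤ (residueFieldCard F : ℝ) ^ (((n : ℤ) + 1) - a) * μ.real (primePowBall F 0) := by
      rw [hμ (a - (n : ℤ)), show -(a - (n : ℤ)) = (n : ℤ) - a by ring]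
      exact mul_le_mul_of_nonneg_right (zpow_le_zpow_right₀ hq1.le (by omega)) hμ0
    calc p n ^ (-(1 / 2 : ℝ)) * μ.real (primePowBall F (a - (n : ℤ)))
        ≤ (c ^ (-(1 / 2 : ℝ)) * (residueFieldCard F : ℝ) ^ (-(((n : ℤ) + 1) - a))) * ((residueFieldCard F : ℝ) ^ (((n : ℤ) + 1) - a) * μ.real (primePowBall F 0)) :=
          mul_le_mul (hpk n) h1 measureReal_nonneg (mul_nonneg hcs (zpow_pos hq0 _).le)
      _ = c ^ (-(1 / 2 : ℝ)) * μ.real (primePowBall F 0) := by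
          rw [zpow_neg]
          field_simp
  refine (norm_shellSum_le μ hp1 a n hz).trans ?_
  calc μ.real (primePowBall F a) + (∑ k ∈ Finset.range n, p k ^ (-(1 / 2 : ℝ)) * (μ.real (primePowBall F (a - ((k : ℤ) + 1))) + μ.real (primePowBall F (a - (k : ℤ))))) +
        p n ^ (-(1 / 2 : ℝ)) * μ.real (primePowBall F (a - (n : ℤ)))
      ≤ (residueFieldCard F : ℝ) ^ (-a) * μ.real (primePowBall F 0) + (∑ _k ∈ Finset.range n, 2 * c ^ (-(1 / 2 : ℝ)) * μ.real (primePowBall F 0)) +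
          c ^ (-(1 / 2 : ℝ)) * μ.real (primePowBall F 0) :=
        add_le_add (add_le_add (le_of_eq (hμ a)) (Finset.sum_le_sum fun k _ => hterm k)) hlast
    _ = ((residueFieldCard F : ℝ) ^ (-a) + (2 * n + 1) * c ^ (-(1 / 2 : ℝ))) * μ.real (primePowBall F 0) := by
        rw [Finset.sum_const, Finset.card_range, nsmul_eq_mul]
        ring

omit [MeasurableSpace F] [BorelSpace F] in
/-- `⋃_K 𝔭^{a−K} = F` (★ `iUnion_primePowBall_neg_nat` shifted by `a`). [folklore] -/
theorem iUnion_ball_sub_nat (a : ℤ) : (⋃ K : ℕ, primePowBall F (a - (K : ℤ))) = Set.univ := by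
  refine Set.eq_univ_of_forall fun t => Set.mem_iUnion.2 ?_
  have ht : t ∈ ⋃ K : ℕ, primePowBall F (-(K : ℤ)) := by rw [iUnion_primePowBall_neg_nat]; exact Set.mem_univ t
  obtain ⟨K, hK⟩ := Set.mem_iUnion.1 ht
  refine ⟨K + a.toNat, primePowBall_antitone ?_ hK⟩
  have := Int.self_le_toNat a
  push_cast
  omega

omit [μ.IsAddHaarMeasure] in
/-- The whole-`F` integral is the limit of the ball integrals along `𝔭^{a−K}` (for an integrand integrable on `F`). [folklore] -/
theorem tendsto_setIntegral_ball_stepSymbol_mul_addChar {P : F → ℝ} {ψ : AddChar F Circle} (ξ : F) (z : ℂ) (a : ℤ)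
    (hint : Integrable (fun t : F => (((P t : ℝ) : ℂ) ^ (-z)) * ((ψ (t * ξ) : Circle) : ℂ)) μ) :
    Tendsto (fun K : ℕ => ∫ t in primePowBall F (a - (K : ℤ)), (((P t : ℝ) : ℂ) ^ (-z)) * ((ψ (t * ξ) : Circle) : ℂ) ∂μ)
      atTop (𝓝 (∫ t, (((P t : ℝ) : ℂ) ^ (-z)) * ((ψ (t * ξ) : Circle) : ℂ) ∂μ)) := by
  have hmono : Monotone fun K : ℕ => primePowBall F (a - (K : ℤ)) := fun b b' hbb' => primePowBall_antitone (by omega)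
  have h := tendsto_setIntegral_of_monotone (μ := μ) (f := fun t : F => (((P t : ℝ) : ℂ) ^ (-z)) * ((ψ (t * ξ) : Circle) : ℂ))
    (fun K : ℕ => measurableSet_primePowBall (a - (K : ℤ))) hmono (by rw [iUnion_ball_sub_nat]; exact hint.integrableOn)
  rwa [iUnion_ball_sub_nat, setIntegral_univ] at h

/-- **THE WHOLE-`F` INTEGRAL IS THE SHELL SUM** — for a step symbol `P` (continuous, `≥ 1`, `= 1` on `𝔭^a`, `= p_k` on the shells), `ψ` continuous of conductor exponent `m`,
`ξ ∈ 𝔭^{m−a+n} ∖ 𝔭^{m−a+n+1}` and an integrand integrable on `F` (the instance: `Re z > ½`):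
`∫_F P(t)^{−z} ψ(tξ) dμ(t) = μ(𝔭^a) + Σ_{k<n} p_k^{−z}(μ(𝔭^{a−k−1}) − μ(𝔭^{a−k})) − p_n^{−z} μ(𝔭^{a−n})`. [cite: Tate1950, §2.5] [cite: JacquetLanglands1970, §3] -/
theorem integral_stepSymbol_mul_addChar_eq_shellSum {P : F → ℝ} (hPc : Continuous P) (hP1 : ∀ t, 1 ≤ P t) {a : ℤ} (hPa : ∀ t ∈ primePowBall F a, P t = 1) {p : ℕ → ℝ}
    (hp : ∀ k : ℕ, ∀ t ∈ primePowBall F (a - ((k : ℤ) + 1)) \ primePowBall F (a - (k : ℤ)), P t = p k)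
    {ψ : AddChar F Circle} (hψ : Continuous ψ) {m : ℤ} (hm : ψ.HasConductorExp m)
    {ξ : F} {n : ℕ} (hn : ξ ∈ primePowBall F (m - a + n)) (hn' : ξ ∉ primePowBall F (m - a + n + 1)) {z : ℂ}
    (hint : Integrable (fun t : F => (((P t : ℝ) : ℂ) ^ (-z)) * ((ψ (t * ξ) : Circle) : ℂ)) μ) :
    ∫ t, (((P t : ℝ) : ℂ) ^ (-z)) * ((ψ (t * ξ) : Circle) : ℂ) ∂μ =
      (μ.real (primePowBall F a) : ℂ) +
        (∑ k ∈ Finset.range n, ((p k : ℝ) : ℂ) ^ (-z) * ((μ.real (primePowBall F (a - ((k : ℤ) + 1))) : ℂ) - (μ.real (primePowBall F (a - (k : ℤ))) : ℂ))) -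
        ((p n : ℝ) : ℂ) ^ (-z) * (μ.real (primePowBall F (a - (n : ℤ))) : ℂ) := by
  refine tendsto_nhds_unique (tendsto_setIntegral_ball_stepSymbol_mul_addChar μ ξ z a hint) ?_
  refine tendsto_const_nhds.congr' ?_
  filter_upwards [Filter.eventually_gt_atTop n] with K hK
  exact (setIntegral_ball_stepSymbol_mul_addChar_eq_shellSum μ hPc hP1 hPa hp hψ hm hn hn' z hK).symm

/-- **VANISHING OF THE WHOLE-`F` INTEGRAL BELOW THE THRESHOLD**: if `ξ ∉ 𝔭^{m−a}` then `∫_F P(t)^{−z} ψ(tξ) dμ(t) = 0` (integrand integrable on `F`). [cite: Tate1950, §2.5] -/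
theorem integral_stepSymbol_mul_addChar_eq_zero_of_not_mem {P : F → ℝ} (hPc : Continuous P) (hP1 : ∀ t, 1 ≤ P t) {a : ℤ} (hPa : ∀ t ∈ primePowBall F a, P t = 1) {p : ℕ → ℝ}
    (hp : ∀ k : ℕ, ∀ t ∈ primePowBall F (a - ((k : ℤ) + 1)) \ primePowBall F (a - (k : ℤ)), P t = p k)
    {ψ : AddChar F Circle} (hψ : Continuous ψ) {m : ℤ} (hm : ψ.HasConductorExp m) {ξ : F} (hξ : ξ ∉ primePowBall F (m - a)) {z : ℂ}
    (hint : Integrable (fun t : F => (((P t : ℝ) : ℂ) ^ (-z)) * ((ψ (t * ξ) : Circle) : ℂ)) μ) :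
    ∫ t, (((P t : ℝ) : ℂ) ^ (-z)) * ((ψ (t * ξ) : Circle) : ℂ) ∂μ = 0 := by
  refine tendsto_nhds_unique (tendsto_setIntegral_ball_stepSymbol_mul_addChar μ ξ z a hint) ?_
  exact tendsto_const_nhds.congr' (Eventually.of_forall fun K =>
    (setIntegral_ball_stepSymbol_mul_addChar_eq_zero_of_not_mem μ hPc hP1 hPa hp hψ hm hξ z K).symm)

end Summit.HodgeConjecture.HodgeConjecture.Cruxes.H413.K2E1FiniteWhittakerStepSymbol

end
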